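import Mathlib
import Summits.NavierStokesRegularity.NavierStokesRegularity.Theorems.ThreadingFluxCentreJetDefs
import HarnessLib

/-!
# Crux `PoloidalLiouville` (stmt-NavierStokesRegularity-1222, W1), crux idea «azimuthal-cartan-test» (ns-idea-15 g10, V26),
# V♯ `LandauVertexFlexibility`: the explicit witness and its local normal forms (DEFINITIONS ONLY)

Named abbreviations for the explicit V♯ witness of the crux note `Cruxes/PoloidalLiouville/AzimuthalCartanVertexWitness.md` and of the
landed bricks `…VertexWitness*.lean` (which spell the same objects as explicit lambdas — `θf`, `gf`, `δvf`, `Φf`, `δpf` below are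
DEFINITIONALLY those lambdas): the potential `θ`, the weight `g`, the velocity `δv = ∇θ + g·id`, the Landau conformal potential `Φ`,
the pressure `δp = g − ⟨∇Φ,∇θ⟩`, and the coefficient functions of the local normal forms `Dθ(y)v = c₀v₀ + c₁v₁ + c₂v₂ + c₃⟪v,y⟫`,
`Dg(y)v = e₀v₀ + e₁v₁ + e₂v₂ + e₃⟪v,y⟫`, `DΦ(y)v = q₂v₂ + q₃⟪v,y⟫`, `curl δv = w`, `δp = Fp` that the momentum computation
(`…VertexWitnessMomentum*.lean`) differentiates once more.  No claims here; `PoloidalLiouville` (1222), V♯, W1 and NS regularity are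
statements elsewhere and stay OPEN until their theorem files land.  `--supports stmt-NavierStokesRegularity-1222 --as helper`; 0 kit.
-/

-- the summit and its single problem share the name (D-0017 nested layout)
set_option linter.dupNamespace false

noncomputable section

open scoped RealInnerProductSpace

namespace Summit.NavierStokesRegularity.NavierStokesRegularity.Theorems.PoloidalLiouville.AzimuthalCartan

open Summit.NavierStokesRegularity.NavierStokesRegularity.Theorems.PoloidalLiouville.CentreJet (E3)

namespace VertexWitness

/-- The radial–axial profile `A = (10r − 8x₂)/((r − x₂)²(2r − x₂))` of the potential `θ = (x₀² − x₁²)·A`. -/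
def Afun (y : E3) : ℝ := (10 * ‖y‖ - 8 * y 2) / ((‖y‖ - y 2) ^ 2 * (2 * ‖y‖ - y 2))

/-- Radial coefficient of `DA`: `DA(y)v = α(y)·|y|⁻¹⟪y,v⟫ + β(y)·v₂` (`VertexWitness.fderiv_A_apply`). -/
def alpha (y : E3) : ℝ := 10 * ((‖y‖ - y 2) ^ 2 * (2 * ‖y‖ - y 2))⁻¹ -
  (10 * ‖y‖ - 8 * y 2) * (((‖y‖ - y 2) ^ 2 * (2 * ‖y‖ - y 2)) ^ 2)⁻¹ * (2 * (‖y‖ - y 2) ^ 2 + 2 * ((2 * ‖y‖ - y 2) * (‖y‖ - y 2)))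

/-- Axial coefficient of `DA` (see `alpha`). -/
def bet (y : E3) : ℝ := -8 * ((‖y‖ - y 2) ^ 2 * (2 * ‖y‖ - y 2))⁻¹ +
  (10 * ‖y‖ - 8 * y 2) * (((‖y‖ - y 2) ^ 2 * (2 * ‖y‖ - y 2)) ^ 2)⁻¹ * ((‖y‖ - y 2) ^ 2 + 2 * ((2 * ‖y‖ - y 2) * (‖y‖ - y 2)))

/-- `Dθ(y)v = c₀v₀ + c₁v₁ + c₂v₂ + c₃⟪v,y⟫`: the coefficient `c₀ = 2A·y₀`. -/
def c0 (y : E3) : ℝ := 2 * Afun y * y 0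

/-- The coefficient `c₁ = −2A·y₁` of `Dθ`. -/
def c1 (y : E3) : ℝ := -(2 * Afun y * y 1)

/-- The coefficient `c₂ = (y₀² − y₁²)·β` of `Dθ`. -/
def c2 (y : E3) : ℝ := (y 0 ^ 2 - y 1 ^ 2) * bet y

/-- The coefficient `c₃ = (y₀² − y₁²)·α/|y|` of `Dθ` (multiplies `⟪v, y⟫`). -/
def c3 (y : E3) : ℝ := (y 0 ^ 2 - y 1 ^ 2) * alpha y * ‖y‖⁻¹

/-- `Dθ(y)` as a continuous linear map: `c₀•proj₀ + c₁•proj₁ + c₂•proj₂ + c₃•⟪y, ·⟫`. -/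
def Lθ (y : E3) : E3 →L[ℝ] ℝ := c0 y • (EuclideanSpace.proj 0 : E3 →L[ℝ] ℝ) + c1 y • (EuclideanSpace.proj 1 : E3 →L[ℝ] ℝ) +
  c2 y • (EuclideanSpace.proj 2 : E3 →L[ℝ] ℝ) + c3 y • (innerSL ℝ y : E3 →L[ℝ] ℝ)

/-- The mode-2 potential `θ = (x₀² − x₁²)(10r − 8x₂)/((r − x₂)²(2r − x₂))` of the V♯ witness (crux note `AzimuthalCartanVertexWitness.md`). -/
def θf (y : E3) : ℝ := (y 0 ^ 2 - y 1 ^ 2) * (10 * ‖y‖ - 8 * y 2) / ((‖y‖ - y 2) ^ 2 * (2 * ‖y‖ - y 2))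

/-- The radial weight `g = 6θ/(2r − x₂)²` of the V♯ witness (`= 2e^Φθ/r²`). -/
def gf (y : E3) : ℝ := 6 * ((y 0 ^ 2 - y 1 ^ 2) * (10 * ‖y‖ - 8 * y 2) / ((‖y‖ - y 2) ^ 2 * (2 * ‖y‖ - y 2))) / (2 * ‖y‖ - y 2) ^ 2

/-- ★ The V♯ witness velocity `δv = ∇θ + g·id` (an azimuthal mode-2 solution of steady NS linearised at Landau's flow `c = 2`). -/
def δvf (y : E3) : E3 := gradient θf y + gf y • y

/-- `Dg(y)v = e₀v₀ + e₁v₁ + e₂v₂ + e₃⟪v,y⟫`: `e₀ = 6c₀/(2r − x₂)²`. -/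
def e0 (y : E3) : ℝ := 6 * c0 y * ((2 * ‖y‖ - y 2) ^ 2)⁻¹

/-- `e₁ = 6c₁/(2r − x₂)²`. -/
def e1 (y : E3) : ℝ := 6 * c1 y * ((2 * ‖y‖ - y 2) ^ 2)⁻¹

/-- `e₂ = 6c₂/(2r − x₂)² + 12θ/(2r − x₂)³`. -/
def e2 (y : E3) : ℝ := 6 * c2 y * ((2 * ‖y‖ - y 2) ^ 2)⁻¹ + 12 * θf y * ((2 * ‖y‖ - y 2) ^ 3)⁻¹

/-- `e₃ = 6c₃/(2r − x₂)² − 24θ/((2r − x₂)³ r)`. -/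
def e3 (y : E3) : ℝ := 6 * c3 y * ((2 * ‖y‖ - y 2) ^ 2)⁻¹ - 24 * θf y * ((2 * ‖y‖ - y 2) ^ 3)⁻¹ * ‖y‖⁻¹

/-- `w = ∇g × id = curl δv` written with `e₀, e₁, e₂`: `(e₁y₂ − e₂y₁, e₂y₀ − e₀y₂, e₀y₁ − e₁y₀)`. -/
def wf (y : E3) : E3 := (e1 y * y 2 - e2 y * y 1) • (EuclideanSpace.single 0 1 : E3) +
  (e2 y * y 0 - e0 y * y 2) • (EuclideanSpace.single 1 1 : E3) + (e0 y * y 1 - e1 y * y 0) • (EuclideanSpace.single 2 1 : E3)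

/-- Landau's conformal potential at `c = 2`: `Φ = log(3r²/(2r − x₂)²)` (`r²ΔΦ + 2e^Φ − 2 = 0`). -/
def Φf (y : E3) : ℝ := Real.log (3 * ‖y‖ ^ 2 / (2 * ‖y‖ - y 2) ^ 2)

/-- ★ The V♯ witness pressure `δp = g − ⟨∇Φ, ∇θ⟩`. -/
def δpf (y : E3) : ℝ := 6 * ((y 0 ^ 2 - y 1 ^ 2) * (10 * ‖y‖ - 8 * y 2) / ((‖y‖ - y 2) ^ 2 * (2 * ‖y‖ - y 2))) /
    (2 * ‖y‖ - y 2) ^ 2 - ⟪gradient Φf y, gradient θf y⟫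

/-- `DΦ(y)v = q₂v₂ + q₃⟪v,y⟫`: `q₂ = 2/(2r − x₂)`. -/
def q2 (y : E3) : ℝ := 2 * (2 * ‖y‖ - y 2)⁻¹

/-- `q₃ = 2/r² − 4/(r(2r − x₂))`. -/
def q3 (y : E3) : ℝ := 2 * (‖y‖ ^ 2)⁻¹ - 4 * ‖y‖⁻¹ * (2 * ‖y‖ - y 2)⁻¹

/-- The pressure in local normal form: `δp = g − Σⱼ (∂ⱼΦ)(∂ⱼθ)` expanded with the `c`- and `q`-coefficients. -/
def Fp (y : E3) : ℝ := gf y - (q3 y * y 0 * (c0 y + c3 y * y 0) + q3 y * y 1 * (c1 y + c3 y * y 1) +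
    (q2 y + q3 y * y 2) * (c2 y + c3 y * y 2))

end VertexWitness

end Summit.NavierStokesRegularity.NavierStokesRegularity.Theorems.PoloidalLiouville.AzimuthalCartan
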